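import Summits.AtomisticToContinuum.HydrodynamicLimit.Theorems.AntiMazurCoboundariesCorrectorPressureDecayKiferGibbsDensityCore

/-!
# The GNZ density sandwich for hard-sphere Gibbs states, II: the insertion (GNZ) lower bound

Helper file (2/3) of crux stmt-AtomisticToContinuum-14135 `AntiMazurCoboundaries.CorrectorPressureDecay`, line `FirstLemma`
(idea `kifer-compactification`), namespace `…Theorems.KiferCompactification`; registered helper stub
`stub_gibbsGNZWindow`; serves the registered stub `stub_activityBound` (the activity bound of the line's skeleton v9) and the
former stub `stub_ruelleDiluteHardSphereGas` (order clause of `RuelleDiluteHardSphereGas`).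
With the notation of `…KiferGibbsDensityCore.lean` (`m = maxwellPhaseMeasure β u Λ`, `w(Y)` the normalising weight) and the
BLOCKED VOLUME `D(X) = ∫ N_{B(p.1, ε) × ℝ³}(X) m(dp)` of a configuration (written out; `measurable_ballCount`,
`measurable_blockedVolume`):

* the GNZ / first-order Mayer inequality, pointwise: `1[hc](x) ≤ 1[hc](cons p x) + 1[hc](x) · N_{B(p.1,ε) × ℝ³}(superposeIn Λ x Y)`
  (`indicator_hardCore_le_cons`), integrated: `m(univ) m^{⊗k}{hc} ≤ m^{⊗(k+1)}{hc} + ∫_{hc} D ∘ superposeIn dm^{⊗k}`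
  (`mass_mul_pi_hardCore_le`), summed against `zᵏ/k!`: `z m(univ) w(Y) ≤ E_W[#Λ] + z E_W[D]`
  (`activity_mul_mass_le_gibbsWeightMeasure`), normalised: `z m(univ) ≤ E_{γ(·|Y)}[#Λ] + z E_{γ(·|Y)}[D]` for `w(Y) < ∞`;
* by the DLR equation for functions and Tonelli, the WINDOW FORM of the GNZ lower bound for every hard-sphere Gibbs state `μ`
  (diameter `ε`, activity `z ≥ 0`, `β > 0`) and bounded measurable `Λ`:
  `z · vol Λ ≤ E_μ[#(particles above Λ)] + z ∫_Λ E_μ[#(centres in B(q, ε))] dq` (`activity_mul_volume_le_of_isHardSphereGibbs`).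
-/

noncomputable section

open MeasureTheory ProbabilityTheory Set Filter Topology Function
open scoped ENNReal

namespace Summit.AtomisticToContinuum.HydrodynamicLimit.Theorems.KiferCompactification

open Literature.Analysis.FluidPDE (IsHardSphereGibbs HardCoreIn superposeIn gibbsWeight gibbsSpec maxwellPhaseMeasure)
open Literature.Analysis.FunctionSpaces (PointConfig)
open Literature.MathematicalPhysics.KineticTheory (V3 gaussMeasure)

/-! ## The lower bound: `z · m(univ) ≤ E_{γ(·|Y)}[#Λ] + z · E_{γ(·|Y)}[blocked volume]` -/

section Lower

/-- **Parametrised ball counts are measurable**: `a ↦ N_{B(g a, ε) × ℝ³}(X a)` (the number of particles of `X a` with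
centre in the open ball `B(g a, ε)`, in `ℝ≥0∞`) is measurable for measurable `X`, `g`. -/
theorem measurable_ballCount {α : Type*} [MeasurableSpace α] (ε : ℝ) {X : α → PointConfig (V3 × V3)} {g : α → V3}
    (hX : Measurable X) (hg : Measurable g) :
    Measurable fun a => (((X a).count (Metric.ball (g a) ε ×ˢ (univ : Set V3)) : ℕ∞) : ℝ≥0∞) := by
  have ht : MeasurableSet {r : α × (V3 × V3) | dist r.2.1 (g r.1) < ε} :=
    measurableSet_lt (measurable_snd.fst.dist (hg.comp measurable_fst)) measurable_const
  have h := PointConfig.measurable_toMeasure_preimage ht hX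
  refine (congrArg Measurable (funext fun a => ?_)).mp h
  rw [PointConfig.toMeasure_apply _ (measurable_prodMk_left ht)]
  congr 2
  ext p
  simp only [mem_preimage, mem_setOf_eq, mem_prod, Metric.mem_ball, mem_univ, and_true]

/-- The **blocked volume** `D(X) = ∫ N_{B(p.1, ε) × ℝ³}(X) m(dp)` of a configuration in the window (`m` the one-particle
a-priori law; for `β > 0` it is `∫_Λ N_{B(q,ε) × ℝ³}(X) dq`, an upper bound for the a-priori mass of the non-insertable points)
is a measurable function of the configuration. -/
theorem measurable_blockedVolume (ε β : ℝ) (u : V3) (Λ : Set V3) :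
    Measurable fun X : PointConfig (V3 × V3) =>
      ∫⁻ p, ((X.count (Metric.ball p.1 ε ×ˢ (univ : Set V3)) : ℕ∞) : ℝ≥0∞) ∂(maxwellPhaseMeasure β u Λ) := by
  haveI := sigmaFinite_maxwellPhaseMeasure β u Λ
  exact (measurable_ballCount ε measurable_fst measurable_snd.fst).lintegral_prod_right'

/-- **The GNZ insertion inequality, pointwise**: `1[hc](x) ≤ 1[hc](cons p x) + 1[hc](x) · N_{B(p.1,ε) × ℝ³}(superposeIn Λ x Y)`
(either the ball around the new centre is vacant, and the insertion keeps the hard core, or it holds a particle). -/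
theorem indicator_hardCore_le_cons (ε : ℝ) (Λ : Set V3) {n : ℕ} (x : Fin n → V3 × V3) (p : V3 × V3)
    (Y : PointConfig (V3 × V3)) :
    {x : Fin n → V3 × V3 | HardCoreIn ε Λ (superposeIn Λ x Y)}.indicator (1 : (Fin n → V3 × V3) → ℝ≥0∞) x ≤
      {x' : Fin (n + 1) → V3 × V3 | HardCoreIn ε Λ (superposeIn Λ x' Y)}.indicator 1 (Fin.cons p x) +
        {x : Fin n → V3 × V3 | HardCoreIn ε Λ (superposeIn Λ x Y)}.indicator 1 x *
          (((superposeIn Λ x Y).count (Metric.ball p.1 ε ×ˢ (univ : Set V3)) : ℕ∞) : ℝ≥0∞) := by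
  by_cases hx : HardCoreIn ε Λ (superposeIn Λ x Y)
  · rw [indicator_of_mem (show x ∈ {x : Fin n → V3 × V3 | HardCoreIn ε Λ (superposeIn Λ x Y)} from hx), Pi.one_apply,
      one_mul]
    by_cases h0 : (superposeIn Λ x Y).count (Metric.ball p.1 ε ×ˢ (univ : Set V3)) = 0
    · rw [indicator_of_mem (show (Fin.cons p x : Fin (n + 1) → V3 × V3) ∈
        {x' : Fin (n + 1) → V3 × V3 | HardCoreIn ε Λ (superposeIn Λ x' Y)} from hardCoreIn_superposeIn_cons hx h0),
        Pi.one_apply]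
      exact le_self_add
    · have h1 : (1 : ℝ≥0∞) ≤ (((superposeIn Λ x Y).count (Metric.ball p.1 ε ×ˢ (univ : Set V3)) : ℕ∞) : ℝ≥0∞) := by
        rw [← ENat.toENNReal_one, ENat.toENNReal_le, Order.one_le_iff_ne_zero]
        exact h0
      exact h1.trans le_add_self
  · rw [indicator_of_notMem (show x ∉ {x : Fin n → V3 × V3 | HardCoreIn ε Λ (superposeIn Λ x Y)} from hx)]
    exact zero_le

/-- **The GNZ insertion inequality for the `k`-particle a-priori masses**:
`m(univ) · m^{⊗k}{hc} ≤ m^{⊗(k+1)}{hc} + ∫_{hc} D(superposeIn Λ x Y) m^{⊗k}(dx)`. -/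
theorem mass_mul_pi_hardCore_le (ε β : ℝ) (u : V3) {Λ : Set V3} (hΛ : MeasurableSet Λ) (Y : PointConfig (V3 × V3))
    (n : ℕ) :
    maxwellPhaseMeasure β u Λ univ *
        (Measure.pi fun _ : Fin n => maxwellPhaseMeasure β u Λ) {x | HardCoreIn ε Λ (superposeIn Λ x Y)} ≤
      (Measure.pi fun _ : Fin (n + 1) => maxwellPhaseMeasure β u Λ) {x | HardCoreIn ε Λ (superposeIn Λ x Y)} +
        ∫⁻ x in {x : Fin n → V3 × V3 | HardCoreIn ε Λ (superposeIn Λ x Y)},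
          ∫⁻ p, (((superposeIn Λ x Y).count (Metric.ball p.1 ε ×ˢ (univ : Set V3)) : ℕ∞) : ℝ≥0∞) ∂(maxwellPhaseMeasure β u Λ)
          ∂(Measure.pi fun _ : Fin n => maxwellPhaseMeasure β u Λ) := by
  haveI := sigmaFinite_maxwellPhaseMeasure β u Λ
  set m := maxwellPhaseMeasure β u Λ with hm
  set Hn : Set (Fin n → V3 × V3) := {x | HardCoreIn ε Λ (superposeIn Λ x Y)} with hHn
  set Hs : Set (Fin (n + 1) → V3 × V3) := {x | HardCoreIn ε Λ (superposeIn Λ x Y)} with hHs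
  have hHnm : MeasurableSet Hn := measurableSet_hardCoreIn_superposeIn_left ε hΛ n Y
  have hHsm : MeasurableSet Hs := measurableSet_hardCoreIn_superposeIn_left ε hΛ (n + 1) Y
  have hA : Measurable fun q : (V3 × V3) × (Fin n → V3 × V3) =>
      Hs.indicator (1 : (Fin (n + 1) → V3 × V3) → ℝ≥0∞) (Fin.cons q.1 q.2) :=
    (measurable_one.indicator hHsm).comp (measurable_finCons n)
  have hXb : Measurable fun q : (V3 × V3) × (Fin n → V3 × V3) =>
      (((superposeIn Λ q.2 Y).count (Metric.ball q.1.1 ε ×ˢ (univ : Set V3)) : ℕ∞) : ℝ≥0∞) :=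
    measurable_ballCount ε ((measurable_superposeIn_left hΛ n Y).comp measurable_snd) measurable_fst.fst
  have hB : Measurable fun q : (V3 × V3) × (Fin n → V3 × V3) => Hn.indicator (1 : (Fin n → V3 × V3) → ℝ≥0∞) q.2 *
      (((superposeIn Λ q.2 Y).count (Metric.ball q.1.1 ε ×ˢ (univ : Set V3)) : ℕ∞) : ℝ≥0∞) :=
    ((measurable_one.indicator hHnm).comp measurable_snd).mul hXb
  calc m univ * (Measure.pi fun _ : Fin n => m) Hn
      = (m.prod (Measure.pi fun _ : Fin n => m)) (univ ×ˢ Hn) := (Measure.prod_prod _ _).symm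
    _ = ∫⁻ q, (univ ×ˢ Hn).indicator 1 q ∂(m.prod (Measure.pi fun _ : Fin n => m)) :=
        (lintegral_indicator_one (MeasurableSet.univ.prod hHnm)).symm
    _ ≤ ∫⁻ q, (Hs.indicator 1 (Fin.cons q.1 q.2) + Hn.indicator 1 q.2 *
          (((superposeIn Λ q.2 Y).count (Metric.ball q.1.1 ε ×ˢ (univ : Set V3)) : ℕ∞) : ℝ≥0∞))
          ∂(m.prod (Measure.pi fun _ : Fin n => m)) := by
        refine lintegral_mono fun q => ?_
        have hq : (univ ×ˢ Hn).indicator (1 : (V3 × V3) × (Fin n → V3 × V3) → ℝ≥0∞) q = Hn.indicator 1 q.2 := by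
          by_cases h : q.2 ∈ Hn
          · rw [indicator_of_mem h, indicator_of_mem (show q ∈ univ ×ˢ Hn from ⟨mem_univ _, h⟩)]
            rfl
          · rw [indicator_of_notMem h, indicator_of_notMem (fun h' : q ∈ univ ×ˢ Hn => h h'.2)]
        rw [hq]
        exact indicator_hardCore_le_cons ε Λ q.2 q.1 Y
    _ = ∫⁻ q, Hs.indicator 1 (Fin.cons q.1 q.2) ∂(m.prod (Measure.pi fun _ : Fin n => m)) +
          ∫⁻ q, Hn.indicator 1 q.2 * (((superposeIn Λ q.2 Y).count (Metric.ball q.1.1 ε ×ˢ (univ : Set V3)) : ℕ∞) : ℝ≥0∞)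
            ∂(m.prod (Measure.pi fun _ : Fin n => m)) :=
        lintegral_add_left hA _
    _ = (Measure.pi fun _ : Fin (n + 1) => m) Hs +
          ∫⁻ x in Hn, ∫⁻ p, (((superposeIn Λ x Y).count (Metric.ball p.1 ε ×ˢ (univ : Set V3)) : ℕ∞) : ℝ≥0∞) ∂m
            ∂(Measure.pi fun _ : Fin n => m) := by
        congr 1
        · rw [lintegral_prod_pi_cons m n (Hs.indicator 1), lintegral_indicator_one hHsm]
        · rw [lintegral_prod_symm _ hB.aemeasurable, ← lintegral_indicator hHnm]
          refine lintegral_congr fun x => ?_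
          by_cases hx : x ∈ Hn
          · simp only [indicator_of_mem hx, Pi.one_apply, one_mul]
          · simp only [indicator_of_notMem hx, zero_mul, lintegral_zero]

/-- **`z · m(univ) · w(Y) ≤ E_W[#Λ] + z · E_W[D]`** (the GNZ insertion inequality summed against the weights `zᵏ/k!`,
with `(k+1) z^{k+1}/(k+1)! = z · zᵏ/k!` and, `m^{⊗k}`-a.e., exactly `k` particles above `Λ`). -/
theorem activity_mul_mass_le_gibbsWeightMeasure (ε : ℝ) {z β : ℝ} (hz : 0 ≤ z) (hβ : 0 < β) (u : V3) {Λ : Set V3}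
    (hΛ : MeasurableSet Λ) (Y : PointConfig (V3 × V3)) :
    ENNReal.ofReal z * maxwellPhaseMeasure β u Λ univ * gibbsWeight ε z β u Λ Y univ ≤
      ∫⁻ X, ((X.count (Λ ×ˢ (univ : Set V3)) : ℕ∞) : ℝ≥0∞) ∂(gibbsWeightMeasure ε z β u Λ Y) +
        ENNReal.ofReal z * ∫⁻ X, ∫⁻ p, ((X.count (Metric.ball p.1 ε ×ˢ (univ : Set V3)) : ℕ∞) : ℝ≥0∞) ∂(maxwellPhaseMeasure β u Λ)
          ∂(gibbsWeightMeasure ε z β u Λ Y) := by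
  haveI := sigmaFinite_maxwellPhaseMeasure β u Λ
  rw [lintegral_gibbsWeightMeasure ε z β u hΛ Y (measurable_toENNReal_count (hΛ.prod MeasurableSet.univ)),
    lintegral_gibbsWeightMeasure ε z β u hΛ Y (measurable_blockedVolume ε β u Λ), gibbsWeight_univ_eq_tsum ε z β u hΛ Y]
  set m := maxwellPhaseMeasure β u Λ with hm
  set P : ℕ → ℝ≥0∞ := fun k => (Measure.pi fun _ : Fin k => m) {x | HardCoreIn ε Λ (superposeIn Λ x Y)} with hP
  set c : ℕ → ℝ≥0∞ := fun k => ENNReal.ofReal (z ^ k / (Nat.factorial k)) with hc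
  set N : ℕ → ℝ≥0∞ := fun k => ∫⁻ x in {x : Fin k → V3 × V3 | HardCoreIn ε Λ (superposeIn Λ x Y)},
      (((superposeIn Λ x Y).count (Λ ×ˢ (univ : Set V3)) : ℕ∞) : ℝ≥0∞) ∂(Measure.pi fun _ : Fin k => m) with hN
  set B : ℕ → ℝ≥0∞ := fun k => ∫⁻ x in {x : Fin k → V3 × V3 | HardCoreIn ε Λ (superposeIn Λ x Y)},
      ∫⁻ p, (((superposeIn Λ x Y).count (Metric.ball p.1 ε ×ˢ (univ : Set V3)) : ℕ∞) : ℝ≥0∞) ∂m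
        ∂(Measure.pi fun _ : Fin k => m) with hB
  show ENNReal.ofReal z * m univ * ∑' k, c k * P k ≤ ∑' k, c k * N k + ENNReal.ofReal z * ∑' k, c k * B k
  -- a.e. exactly `k` particles above `Λ`
  have hcount : ∀ k : ℕ, N k = k * P k := by
    intro k
    rw [hN, hP]
    dsimp only
    rw [← setLIntegral_const]
    refine setLIntegral_congr_fun_ae (measurableSet_hardCoreIn_superposeIn_left ε hΛ k Y) ?_
    filter_upwards [ae_pi_maxwellPhaseMeasure_good hβ u hΛ k] with x hx _
    rw [count_superposeIn_eq_of_injective Λ hx.1 hx.2 Y, ENat.toENNReal_coe]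
  have hstep : ∀ n : ℕ, ENNReal.ofReal z * m univ * (c n * P n) ≤
      c (n + 1) * (((n + 1 : ℕ) : ℝ≥0∞) * P (n + 1)) + ENNReal.ofReal z * (c n * B n) := by
    intro n
    calc ENNReal.ofReal z * m univ * (c n * P n) = ENNReal.ofReal z * c n * (m univ * P n) := by ring
      _ ≤ ENNReal.ofReal z * c n * (P (n + 1) + B n) := mul_le_mul' le_rfl (mass_mul_pi_hardCore_le ε β u hΛ Y n)
      _ = ENNReal.ofReal z * c n * P (n + 1) + ENNReal.ofReal z * (c n * B n) := by ring
      _ = _ := by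
          rw [hc]
          dsimp only
          rw [← ofReal_pow_succ_div_factorial_mul hz n]
          ring
  calc ENNReal.ofReal z * m univ * ∑' k, c k * P k = ∑' k, ENNReal.ofReal z * m univ * (c k * P k) :=
        ENNReal.tsum_mul_left.symm
    _ ≤ ∑' n, (c (n + 1) * (((n + 1 : ℕ) : ℝ≥0∞) * P (n + 1)) + ENNReal.ofReal z * (c n * B n)) :=
        ENNReal.tsum_le_tsum hstep
    _ = ∑' n, c (n + 1) * (((n + 1 : ℕ) : ℝ≥0∞) * P (n + 1)) + ∑' n, ENNReal.ofReal z * (c n * B n) := ENNReal.tsum_add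
    _ = ∑' k, c k * ((k : ℝ≥0∞) * P k) + ENNReal.ofReal z * ∑' n, c n * B n := by
        congr 1
        · rw [tsum_eq_zero_add' (f := fun k => c k * ((k : ℝ≥0∞) * P k)) ENNReal.summable, Nat.cast_zero, zero_mul,
            mul_zero, zero_add]
        · exact ENNReal.tsum_mul_left
    _ = ∑' k, c k * N k + ENNReal.ofReal z * ∑' n, c n * B n := by
        simp_rw [hcount]

/-- **`z · m(univ) ≤ E_{γ(·|Y)}[#Λ] + z · E_{γ(·|Y)}[D]`** for every boundary condition of finite weight. -/
theorem activity_mul_mass_le_gibbsSpecMeasure (ε : ℝ) {z β : ℝ} (hz : 0 ≤ z) (hβ : 0 < β) (u : V3) {Λ : Set V3}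
    (hΛ : MeasurableSet Λ) {Y : PointConfig (V3 × V3)} (hY : gibbsWeight ε z β u Λ Y univ ≠ ∞) :
    ENNReal.ofReal z * maxwellPhaseMeasure β u Λ univ ≤
      ∫⁻ X, ((X.count (Λ ×ˢ (univ : Set V3)) : ℕ∞) : ℝ≥0∞) ∂(gibbsSpecMeasure ε z β u Λ Y) +
        ENNReal.ofReal z * ∫⁻ X, ∫⁻ p, ((X.count (Metric.ball p.1 ε ×ˢ (univ : Set V3)) : ℕ∞) : ℝ≥0∞) ∂(maxwellPhaseMeasure β u Λ)
          ∂(gibbsSpecMeasure ε z β u Λ Y) := by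
  set w := gibbsWeight ε z β u Λ Y univ with hw
  have hw0 : w ≠ 0 := gibbsWeight_univ_ne_zero ε z β u Λ Y
  rw [lintegral_gibbsSpecMeasure, lintegral_gibbsSpecMeasure]
  calc ENNReal.ofReal z * maxwellPhaseMeasure β u Λ univ = w⁻¹ * (ENNReal.ofReal z * maxwellPhaseMeasure β u Λ univ * w) := by
        rw [mul_comm w⁻¹, mul_assoc, ENNReal.mul_inv_cancel hw0 hY, mul_one]
    _ ≤ w⁻¹ * (∫⁻ X, ((X.count (Λ ×ˢ (univ : Set V3)) : ℕ∞) : ℝ≥0∞) ∂(gibbsWeightMeasure ε z β u Λ Y) +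
          ENNReal.ofReal z * ∫⁻ X, ∫⁻ p, ((X.count (Metric.ball p.1 ε ×ˢ (univ : Set V3)) : ℕ∞) : ℝ≥0∞)
            ∂(maxwellPhaseMeasure β u Λ) ∂(gibbsWeightMeasure ε z β u Λ Y)) :=
        mul_le_mul' le_rfl (activity_mul_mass_le_gibbsWeightMeasure ε hz hβ u hΛ Y)
    _ = _ := by rw [mul_add]; ring

/-- **`z · m(univ) ≤ E_μ[#Λ] + z · E_μ[D]`** for a hard-sphere Gibbs state (DLR for functions on both sides). -/
theorem activity_mul_mass_le_of_isHardSphereGibbs {ε z β : ℝ} {u : V3} {μ : Measure (PointConfig (V3 × V3))}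
    (h : IsHardSphereGibbs ε z β u μ) (hz : 0 ≤ z) (hβ : 0 < β) {Λ : Set V3} (hΛ : MeasurableSet Λ)
    (hΛb : Bornology.IsBounded Λ) :
    ENNReal.ofReal z * maxwellPhaseMeasure β u Λ univ ≤
      ∫⁻ X, ((X.count (Λ ×ˢ (univ : Set V3)) : ℕ∞) : ℝ≥0∞) ∂μ +
        ENNReal.ofReal z * ∫⁻ X, ∫⁻ p, ((X.count (Metric.ball p.1 ε ×ˢ (univ : Set V3)) : ℕ∞) : ℝ≥0∞) ∂(maxwellPhaseMeasure β u Λ) ∂μ := by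
  haveI := h.1
  have hcm := measurable_toENNReal_count (hΛ.prod (MeasurableSet.univ : MeasurableSet (univ : Set V3)))
  have hDm := measurable_blockedVolume ε β u Λ
  have h1 : Measurable fun Y => ∫⁻ X, ((X.count (Λ ×ˢ (univ : Set V3)) : ℕ∞) : ℝ≥0∞) ∂(gibbsSpecMeasure ε z β u Λ Y) :=
    (Measure.measurable_lintegral hcm).comp (measurable_gibbsSpecMeasure ε z β u hΛ)
  have h2 : Measurable fun Y => ∫⁻ X, ∫⁻ p, ((X.count (Metric.ball p.1 ε ×ˢ (univ : Set V3)) : ℕ∞) : ℝ≥0∞)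
      ∂(maxwellPhaseMeasure β u Λ) ∂(gibbsSpecMeasure ε z β u Λ Y) :=
    (Measure.measurable_lintegral hDm).comp (measurable_gibbsSpecMeasure ε z β u hΛ)
  rw [lintegral_eq_lintegral_gibbsSpecMeasure h hΛ hΛb hcm.aemeasurable,
    lintegral_eq_lintegral_gibbsSpecMeasure h hΛ hΛb hDm.aemeasurable, ← lintegral_const_mul _ h2,
    ← lintegral_add_left h1]
  calc ENNReal.ofReal z * maxwellPhaseMeasure β u Λ univ = ∫⁻ _, ENNReal.ofReal z * maxwellPhaseMeasure β u Λ univ ∂μ := by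
        rw [lintegral_const, show μ univ = 1 from measure_univ, mul_one]
    _ ≤ _ := lintegral_mono_ae ?_
  filter_upwards [ae_gibbsWeight_univ_ne_top h hΛ hΛb] with Y hY
  exact activity_mul_mass_le_gibbsSpecMeasure ε hz hβ u hΛ hY

/-- The mean blocked volume is the `Λ`-integral of the mean number of centres in the balls `B(q, ε)` (Tonelli; the
velocity factor of the a-priori law is a probability measure). -/
theorem lintegral_blockedVolume_eq (ε : ℝ) {β : ℝ} (hβ : 0 < β) (u : V3) (Λ : Set V3)
    (μ : Measure (PointConfig (V3 × V3))) [SFinite μ] :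
    ∫⁻ X, ∫⁻ p, ((X.count (Metric.ball p.1 ε ×ˢ (univ : Set V3)) : ℕ∞) : ℝ≥0∞) ∂(maxwellPhaseMeasure β u Λ) ∂μ =
      ∫⁻ q in Λ, ∫⁻ X, ((X.count (Metric.ball q ε ×ˢ (univ : Set V3)) : ℕ∞) : ℝ≥0∞) ∂μ := by
  haveI := sigmaFinite_maxwellPhaseMeasure β u Λ
  have hg : Measurable fun q : V3 => ∫⁻ X, ((X.count (Metric.ball q ε ×ˢ (univ : Set V3)) : ℕ∞) : ℝ≥0∞) ∂μ :=
    (measurable_ballCount ε measurable_fst measurable_snd).lintegral_prod_left'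
  have hsw : AEMeasurable (uncurry fun (X : PointConfig (V3 × V3)) (p : V3 × V3) =>
      ((X.count (Metric.ball p.1 ε ×ˢ (univ : Set V3)) : ℕ∞) : ℝ≥0∞)) (μ.prod (maxwellPhaseMeasure β u Λ)) :=
    (measurable_ballCount ε measurable_fst measurable_snd.fst).aemeasurable
  rw [lintegral_lintegral_swap hsw, maxwellPhaseMeasure_eq_prod_gaussMeasure hβ u Λ,
    lintegral_prod (fun p : V3 × V3 => ∫⁻ X, ((X.count (Metric.ball p.1 ε ×ˢ (univ : Set V3)) : ℕ∞) : ℝ≥0∞) ∂μ)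
      (hg.comp measurable_fst).aemeasurable]
  simp only [lintegral_const, measure_univ, mul_one]

/-- **The GNZ lower bound, window form**: for a hard-sphere Gibbs state `μ` of diameter `ε`, activity `z ≥ 0`, `β > 0`, and
a bounded measurable window `Λ`,
`z · vol Λ ≤ E_μ[#(particles above Λ)] + z ∫_Λ E_μ[#(particles with centre in B(q, ε))] dq`. -/
theorem activity_mul_volume_le_of_isHardSphereGibbs {ε z β : ℝ} {u : V3} {μ : Measure (PointConfig (V3 × V3))}
    (h : IsHardSphereGibbs ε z β u μ) (hz : 0 ≤ z) (hβ : 0 < β) {Λ : Set V3} (hΛ : MeasurableSet Λ)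
    (hΛb : Bornology.IsBounded Λ) :
    ENNReal.ofReal z * volume Λ ≤ ∫⁻ X, ((X.count (Λ ×ˢ (univ : Set V3)) : ℕ∞) : ℝ≥0∞) ∂μ +
      ENNReal.ofReal z * ∫⁻ q in Λ, ∫⁻ X, ((X.count (Metric.ball q ε ×ˢ (univ : Set V3)) : ℕ∞) : ℝ≥0∞) ∂μ := by
  haveI := h.1
  rw [← maxwellPhaseMeasure_univ hβ u Λ, ← lintegral_blockedVolume_eq ε hβ u Λ μ]
  exact activity_mul_mass_le_of_isHardSphereGibbs h hz hβ hΛ hΛb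

/-- **Registered helper stub `stub_gibbsGNZWindow`** (file 2/3 of the density sandwich): the window form of the GNZ lower
bound, `z · vol Λ ≤ E_μ[#(particles above Λ)] + z ∫_Λ E_μ[#(centres in B(q, ε))] dq`, for every hard-sphere Gibbs state of
diameter `ε`, activity `z ≥ 0`, `β > 0`, and every bounded measurable window `Λ`. -/
theorem stub_gibbsGNZWindow : ∀ (ε z β : ℝ) (u : V3) (μ : Measure (PointConfig (V3 × V3))), IsHardSphereGibbs ε z β u μ → 0 ≤ z → 0 < β → ∀ (Λ : Set V3), MeasurableSet Λ → Bornology.IsBounded Λ → ENNReal.ofReal z * volume Λ ≤ ∫⁻ X, ((X.count (Λ ×ˢ (univ : Set V3)) : ℕ∞) : ℝ≥0∞) ∂μ + ENNReal.ofReal z * ∫⁻ q in Λ, ∫⁻ X, ((X.count (Metric.ball q ε ×ˢ (univ : Set V3)) : ℕ∞) : ℝ≥0∞) ∂μ :=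
  fun _ _ _ _ _ h hz hβ _ hΛ hΛb => activity_mul_volume_le_of_isHardSphereGibbs h hz hβ hΛ hΛb

end Lower

end Summit.AtomisticToContinuum.HydrodynamicLimit.Theorems.KiferCompactification
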